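/-
Copyright (c) 2026 the pub-hodgecm-mathlib formalisation cell (harness21).  Prover seat hodgecm-mathlib-B-p08 (g41): unit U2G_Census (tier-1 assembler), tier-2 spine file 2:
the profile labels of the ★ №3 pieces TRANSPORTED from the conjugate `g⁻¹Xg` to the vertex `g·𝒪³` (the `P ↔ Q` clause of the predicate dictionary); 2026-09-03.
-/
import Summits.HodgeConjecture.HodgeConjecture.Theorems.F0P3cDyRamFourFrameCensusDefs   -- ★ p854672 (B-p08 (g41)): `LatticeInLevel`, `LatticeNearTransvShell`, `latticeValueSetMod`, `LatticeLabelPlus`;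
                                                                                   -- brings ★ №3 `InLevel`, `NearTransvShell`, `valueSetMod`, `LabelPlus`, `xPlus`
import Literature.NumberTheory.Automorphic.UnitaryLatticeTreeFixedCosetStrataDictionary  -- ★ `map_toLin'_mapGL_stdLattice_le_scaleLattice_iff` (`A·(g·L₀) ⊆ c·(g·L₀) ↔ g⁻¹Ag ∈ c·M_N(𝒪)`)
import Literature.NumberTheory.Automorphic.UnitaryLatticeTreeApartment                  -- ★ `pairing_mulVec_mulVec_of_mem_unitary` (`⟨uy, uz⟩ = ⟨y, z⟩`)
import Literature.NumberTheory.Automorphic.UnitaryLatticeTreeDual                       -- ★ `mem_latt_iff_of_isUnit` (`x ∈ g·𝒪^N ↔ g⁻¹x ∈ 𝒪^N`)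
import Literature.NumberTheory.Automorphic.UnitaryThreeFourFrameDefectModuleShape         -- ★ p854564 (B-p08 (g41)): `conj_mul_conj` (`(g⁻¹Pg)(g⁻¹Qg) = g⁻¹(PQ)g`)
import HarnessLib

/-!
# Crux `H413`, line LH4 «(D-RAM) FOUR-FRAME» road — unit U2G, TIER-2 SPINE 2: the profile labels transported to the vertex,
# `InLevel ϖ ℓ (g⁻¹Xg) ↔ LatticeInLevel ϖ ℓ X (g·𝒪³)`, `valueSetMod σ ϖ m (g⁻¹Xg) = latticeValueSetMod σ ϖ m (g·𝒪³) X` (`g` unitary), hence shell and label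

Cell `hodgecm-mathlib` (D-0151), FLOOR 0, crux item H413 = `stmt-HodgeConjecture-24833`, route of record `HCCMUnconditional`; squad F0∕P3c∕LH4 (req618); tier-1 unit U2G_Census
(assembler B-p08 (g41)).  THEOREMS ONLY (no `def`, no instance, no notation, no `sorry`); datum-free (`K` any field with `Valued K ℤᵐ⁰`, any `σ`, any `ϖ ≠ 0`, any `g ∈ GL₃(K)`, unitary for `Φ₃` where said); lane `--supports stmt-HodgeConjecture-24833 --as helper` (count-neutral).

WHY.  The U2G stubs `stub_U2G_dict_transvPlus ∕ transvMinus ∕ reg : PieceCountDictionary ‹piece› ‹count›` (module `Cruxes/H413/Lines/F0_P3c_DyRamFourFrame/U2G_Census.lean`) say: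
the orbital integral of a PROFILE PIECE `f = 1_{K ∩ {u | profile(wMatrix u − 1)}}` (★ №3 `pieceTransvPlus ∕ pieceTransvMinus ∕ pieceReg`; profiles `NearTransvShell`, `LabelPlus`,
`¬ InLevel m (X²)`) at a type-(1) literal `γ` is `νG₃(K) ·` the number of type-0 vertices `M` fixed by `T = ι_w γ` carrying the VERTEX-SIDE profile of `X = T − 1` (★ p854672
`LatticeNearTransvShell`, `LatticeLabelPlus`, `LatticeInLevel`).  By ★ `classOrbitalIntegral_eq_sum_fixedBy_of_support_subset_of_conj_invariant` (orbital integral = `ν(K) ·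
Σ_{gK fixed} f(g⁻¹γg)`) and the predicate dictionary ★ `ncard_fixedBy_quotient_sep_eq_ncard_isVertexLattice_fixed_sep` (spine 1), everything reduces to the clause
«`profile(g⁻¹Xg) ↔ PROFILE(g·𝒪³, X)` for unitary `g`» — THIS FILE.

THE MATHEMATICS ([Kottwitz1986, §3]; [Rogawski1990, §4.9 p. 54]).  `g ∈ GL₃(K)`, `M := g·𝒪³` (★ `mapGL g (stdLattice K 3)`), `X ∈ M₃(K)`, `ϖ ≠ 0`.
* §1 LEVELS: `InLevel ϖ ℓ (g⁻¹Xg) ↔ LatticeInLevel ϖ ℓ X M` — both say `g⁻¹Xg ∈ ϖ^ℓ·M₃(𝒪)` (★ `map_toLin'_mapGL_stdLattice_le_scaleLattice_iff` + `|ϖ^{−ℓ}y| ≤ 1 ↔ |y| ≤ |ϖ^ℓ|`);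
  with `(g⁻¹Xg)² = g⁻¹X²g` (★ `conj_mul_conj`): `NearTransvShell ϖ ℓ m (g⁻¹Xg) ↔ LatticeNearTransvShell ϖ ℓ m X M`.
* §2 VALUE SETS, `g ∈ U(σ, Φ₃)`: `y ↦ gy` maps `𝒪³` onto `M` (★ `mem_latt_iff_of_isUnit`) and `⟨gy, X(gy)⟩ = ⟨y, (g⁻¹Xg)y⟩` (★ `pairing_mulVec_mulVec_of_mem_unitary`), so
  `valueSetMod σ ϖ m (g⁻¹Xg) = latticeValueSetMod σ ϖ m M X` and `LabelPlus σ ϖ d m (g⁻¹Xg) ↔ LatticeLabelPlus σ ϖ d m M X`.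
* §3 THE `P ↔ Q` CLAUSES for the three profile pieces, in the shape spine 1 consumes (`g⁻¹Tg − 1 = g⁻¹(T − 1)g`).
HONEST LABEL.  Count-neutral; the verdict of record for (D-RAM) stays PRINT [LanglandsShelstad1989 Thm. p. 484 ∕ Rogawski1990 Prop. 4.9.1 (a)] ∕ XL; `HC_CM` is proved only
modulo the 7 printed citations (2 remaining: hLiu418 = `stmt-HodgeConjecture-24832`, h413 = `stmt-HodgeConjecture-24833`) until rung 0 closes.

## References
* [Kottwitz1986] R. E. Kottwitz, *Base change for unit elements of Hecke algebras*, Compositio Math. 60 (1986), §3 (reading the class of `γ` at a fixed vertex).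
* [Rogawski1990] J. D. Rogawski, *Automorphic Representations of Unitary Groups in Three Variables*, Ann. of Math. Stud. 123 (1990), §4.9 Prop. 4.9.1 (b) pp. 54–55.
-/

noncomputable section

namespace Summit.HodgeConjecture.HodgeConjecture.Cruxes.H413.F0P3cDyRamProfileLabelTransport

open Literature.NumberTheory.Automorphic Literature.NumberTheory.Automorphic.HermitianLattice
  Literature.NumberTheory.Automorphic.UnitaryLatticeTree Literature.NumberTheory.Automorphic.UnitaryThreeFourFrame
open Summit.HodgeConjecture.HodgeConjecture.Cruxes.H413.F0P3cDyRamFourFramePieces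
open Summit.HodgeConjecture.HodgeConjecture.Cruxes.H413.F0P3cDyRamFourFrameCensusDefs
open scoped Valued WithZero Matrix MatrixGroups

variable {K : Type*} [Field K] [Valued K ℤᵐ⁰]

/-! ## §1  Levels: `InLevel ϖ ℓ (g⁻¹Xg) ↔ LatticeInLevel ϖ ℓ X (g·𝒪³)` -/

/-- `|c⁻¹·y| ≤ 1 ↔ |y| ≤ |c|` for `c ≠ 0` (private copy of ★ `UnitaryGroup.v_inv_mul_le_one_iff`, kept local to avoid an unrelated import). [cite: Kottwitz1986, §3] -/
private theorem v_inv_mul_le_one_iff {c : K} (hc : c ≠ 0) (y : K) : Valued.v (c⁻¹ * y) ≤ 1 ↔ Valued.v y ≤ Valued.v c := by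
  rw [map_mul, map_inv₀, inv_mul_le_one₀ ((Valuation.pos_iff _).2 hc)]

/-- **LEVEL TRANSPORT**: `g⁻¹Xg ∈ ϖ^ℓ·M₃(𝒪)` read entrywise (★ №3 `InLevel`) iff `X·(g·𝒪³) ⊆ ϖ^ℓ·(g·𝒪³)` (★ p854672 `LatticeInLevel`), for every `g ∈ GL₃(K)`, `ϖ ≠ 0`.
[cite: Kottwitz1986, §3] [cite: Rogawski1990, §4.9 Prop. 4.9.1 (b) p. 55] -/
theorem inLevel_conj_iff_latticeInLevel {ϖ : K} (hϖ : ϖ ≠ 0) (ℓ : ℕ) (X : Matrix (Fin 3) (Fin 3) K) (g : GL (Fin 3) K) :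
    InLevel ϖ ℓ ((g : Matrix (Fin 3) (Fin 3) K)⁻¹ * X * (g : Matrix (Fin 3) (Fin 3) K)) ↔ LatticeInLevel ϖ ℓ X (mapGL g (stdLattice K 3)) := by
  rw [LatticeInLevel, map_toLin'_mapGL_stdLattice_le_scaleLattice_iff (pow_ne_zero ℓ hϖ) X g, InLevel]
  exact forall_congr' fun a => forall_congr' fun b => v_inv_mul_le_one_iff (pow_ne_zero ℓ hϖ) _

/-- **SHELL TRANSPORT**: `NearTransvShell ϖ ℓ m (g⁻¹Xg) ↔ LatticeNearTransvShell ϖ ℓ m X (g·𝒪³)` (the square transported by ★ `conj_mul_conj`). [cite: Kottwitz1986, §3] -/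
theorem nearTransvShell_conj_iff_latticeNearTransvShell {ϖ : K} (hϖ : ϖ ≠ 0) (ℓ m : ℕ) (X : Matrix (Fin 3) (Fin 3) K) (g : GL (Fin 3) K) :
    NearTransvShell ϖ ℓ m ((g : Matrix (Fin 3) (Fin 3) K)⁻¹ * X * (g : Matrix (Fin 3) (Fin 3) K)) ↔
      LatticeNearTransvShell ϖ ℓ m X (mapGL g (stdLattice K 3)) := by
  have hsq : (g : Matrix (Fin 3) (Fin 3) K)⁻¹ * X * (g : Matrix (Fin 3) (Fin 3) K) * ((g : Matrix (Fin 3) (Fin 3) K)⁻¹ * X * (g : Matrix (Fin 3) (Fin 3) K)) =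
      (g : Matrix (Fin 3) (Fin 3) K)⁻¹ * (X * X) * (g : Matrix (Fin 3) (Fin 3) K) := by
    rw [Matrix.mul_assoc ((g : Matrix (Fin 3) (Fin 3) K)⁻¹) X (g : Matrix (Fin 3) (Fin 3) K), conj_mul_conj g X X]
    simp only [Matrix.mul_assoc]
  rw [NearTransvShell, LatticeNearTransvShell, hsq, inLevel_conj_iff_latticeInLevel hϖ, inLevel_conj_iff_latticeInLevel hϖ, inLevel_conj_iff_latticeInLevel hϖ]

/-! ## §2  Value sets (`g` unitary): `valueSetMod σ ϖ m (g⁻¹Xg) = latticeValueSetMod σ ϖ m (g·𝒪³) X` -/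

omit [Valued K ℤᵐ⁰] in
/-- `⟨gy, X(gy)⟩ = ⟨y, (g⁻¹Xg)y⟩` for `g ∈ U(σ, Φ₃)` (★ `pairing_mulVec_mulVec_of_mem_unitary` with `g(g⁻¹Xg)y = X(gy)`). [cite: Rogawski1990, §4.9 Prop. 4.9.1 (b) p. 55] -/
theorem pairing_mulVec_conj_eq (σ : K →+* K) {g : GL (Fin 3) K} (hg : g ∈ unitaryGroupOfForm σ ((StdForm.antidiagonal 3).over K))
    (X : Matrix (Fin 3) (Fin 3) K) (y : Fin 3 → K) :
    pairing σ ((StdForm.antidiagonal 3).over K) ((g : Matrix (Fin 3) (Fin 3) K).mulVec y)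
        (X.mulVec ((g : Matrix (Fin 3) (Fin 3) K).mulVec y)) =
      pairing σ ((StdForm.antidiagonal 3).over K) y (((g : Matrix (Fin 3) (Fin 3) K)⁻¹ * X * (g : Matrix (Fin 3) (Fin 3) K)).mulVec y) := by
  have e : X.mulVec ((g : Matrix (Fin 3) (Fin 3) K).mulVec y) =
      (g : Matrix (Fin 3) (Fin 3) K).mulVec ((((g : Matrix (Fin 3) (Fin 3) K)⁻¹ * X * (g : Matrix (Fin 3) (Fin 3) K))).mulVec y) := by
    rw [Matrix.mulVec_mulVec, Matrix.mulVec_mulVec, Matrix.mul_assoc ((g : Matrix (Fin 3) (Fin 3) K)⁻¹) X (g : Matrix (Fin 3) (Fin 3) K),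
      Matrix.mul_nonsing_inv_cancel_left _ _ (Matrix.isUnits_det_units g)]
  rw [e, pairing_mulVec_mulVec_of_mem_unitary hg]

/-- **VALUE-SET TRANSPORT**: for `g ∈ U(σ, Φ₃)`, the thickened value set of `g⁻¹Xg` on `𝒪³` (★ №3 `valueSetMod`) is that of `X` on `g·𝒪³` (★ p854672 `latticeValueSetMod`).
[cite: Rogawski1990, §4.9 Prop. 4.9.1 (b) p. 55] [cite: Kottwitz1986, §3] -/
theorem valueSetMod_conj_eq_latticeValueSetMod (σ : K →+* K) (ϖ : K) (m : ℕ) (X : Matrix (Fin 3) (Fin 3) K) {g : GL (Fin 3) K}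
    (hg : g ∈ unitaryGroupOfForm σ ((StdForm.antidiagonal 3).over K)) :
    valueSetMod σ ϖ m ((g : Matrix (Fin 3) (Fin 3) K)⁻¹ * X * (g : Matrix (Fin 3) (Fin 3) K)) = latticeValueSetMod σ ϖ m (mapGL g (stdLattice K 3)) X := by
  have hdet : IsUnit (g : Matrix (Fin 3) (Fin 3) K).det := Matrix.isUnits_det_units g
  ext z
  simp only [valueSetMod, latticeValueSetMod, Set.mem_setOf_eq]
  constructor
  · rintro ⟨y, hy, hz⟩
    refine ⟨(g : Matrix (Fin 3) (Fin 3) K).mulVec y, ?_, ?_⟩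
    · -- `gy ∈ g·𝒪³`
      change (g : Matrix (Fin 3) (Fin 3) K).mulVec y ∈ latt (g : Matrix (Fin 3) (Fin 3) K)
      rw [mem_latt_iff_of_isUnit hdet, Matrix.mulVec_mulVec, Matrix.nonsing_inv_mul _ hdet, Matrix.one_mulVec]
      exact hy
    · rwa [pairing_mulVec_conj_eq σ hg]
  · rintro ⟨y', hy', hz⟩
    refine ⟨(g : Matrix (Fin 3) (Fin 3) K)⁻¹.mulVec y', ?_, ?_⟩
    · have hmem : y' ∈ latt (g : Matrix (Fin 3) (Fin 3) K) := hy'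
      exact (mem_latt_iff_of_isUnit hdet y').1 hmem
    · have e : (g : Matrix (Fin 3) (Fin 3) K).mulVec ((g : Matrix (Fin 3) (Fin 3) K)⁻¹.mulVec y') = y' := by
        rw [Matrix.mulVec_mulVec, Matrix.mul_nonsing_inv _ hdet, Matrix.one_mulVec]
      rw [← pairing_mulVec_conj_eq σ hg, e]
      exact hz

/-- **LABEL TRANSPORT**: `LabelPlus σ ϖ d m (g⁻¹Xg) ↔ LatticeLabelPlus σ ϖ d m (g·𝒪³) X` for `g ∈ U(σ, Φ₃)`. [cite: Rogawski1990, §4.9 Prop. 4.9.1 (b) p. 55] -/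
theorem labelPlus_conj_iff_latticeLabelPlus (σ : K →+* K) (ϖ : K) (d m : ℕ) (X : Matrix (Fin 3) (Fin 3) K) {g : GL (Fin 3) K}
    (hg : g ∈ unitaryGroupOfForm σ ((StdForm.antidiagonal 3).over K)) :
    LabelPlus σ ϖ d m ((g : Matrix (Fin 3) (Fin 3) K)⁻¹ * X * (g : Matrix (Fin 3) (Fin 3) K)) ↔ LatticeLabelPlus σ ϖ d m (mapGL g (stdLattice K 3)) X := by
  rw [LabelPlus, LatticeLabelPlus, valueSetMod_conj_eq_latticeValueSetMod σ ϖ m X hg]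

/-! ## §3  The `P ↔ Q` clauses of the three profile pieces (`T` acting, `X = T − 1`, `g⁻¹Tg − 1 = g⁻¹(T − 1)g`) -/

omit [Valued K ℤᵐ⁰] in
/-- `g⁻¹Tg − 1 = g⁻¹(T − 1)g`. [cite: Kottwitz1986, §3] -/
theorem conj_sub_one (T : Matrix (Fin 3) (Fin 3) K) (g : GL (Fin 3) K) :
    (g : Matrix (Fin 3) (Fin 3) K)⁻¹ * T * (g : Matrix (Fin 3) (Fin 3) K) - 1 =
      (g : Matrix (Fin 3) (Fin 3) K)⁻¹ * (T - 1) * (g : Matrix (Fin 3) (Fin 3) K) := by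
  rw [Matrix.mul_sub, Matrix.sub_mul, Matrix.mul_one, Matrix.nonsing_inv_mul _ (Matrix.isUnits_det_units g)]

/-- **THE `f_{T+}` CLAUSE**: for unitary `g`, `T ∈ GL₃(K)`: the shell-and-label profile of `g⁻¹Tg − 1` on `𝒪³` iff the vertex-side profile of `T − 1` at `g·𝒪³`.
[cite: Kottwitz1986, §3] [cite: Rogawski1990, §4.9 Prop. 4.9.1 (b) p. 55] -/
theorem transvPlus_profile_conj_iff (σ : K →+* K) {ϖ : K} (hϖ : ϖ ≠ 0) (d ℓ m : ℕ) (T : Matrix (Fin 3) (Fin 3) K) {g : GL (Fin 3) K}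
    (hg : g ∈ unitaryGroupOfForm σ ((StdForm.antidiagonal 3).over K)) :
    (NearTransvShell ϖ ℓ m ((g : Matrix (Fin 3) (Fin 3) K)⁻¹ * T * (g : Matrix (Fin 3) (Fin 3) K) - 1) ∧
        LabelPlus σ ϖ d m ((g : Matrix (Fin 3) (Fin 3) K)⁻¹ * T * (g : Matrix (Fin 3) (Fin 3) K) - 1)) ↔
      (LatticeNearTransvShell ϖ ℓ m (T - 1) (mapGL g (stdLattice K 3)) ∧ LatticeLabelPlus σ ϖ d m (mapGL g (stdLattice K 3)) (T - 1)) := by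
  rw [conj_sub_one, nearTransvShell_conj_iff_latticeNearTransvShell hϖ, labelPlus_conj_iff_latticeLabelPlus σ ϖ d m (T - 1) hg]

/-- **THE `f_{T−}` CLAUSE** (label negated). [cite: Kottwitz1986, §3] [cite: Rogawski1990, §4.9 Prop. 4.9.1 (b) p. 55] -/
theorem transvMinus_profile_conj_iff (σ : K →+* K) {ϖ : K} (hϖ : ϖ ≠ 0) (d ℓ m : ℕ) (T : Matrix (Fin 3) (Fin 3) K) {g : GL (Fin 3) K}
    (hg : g ∈ unitaryGroupOfForm σ ((StdForm.antidiagonal 3).over K)) :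
    (NearTransvShell ϖ ℓ m ((g : Matrix (Fin 3) (Fin 3) K)⁻¹ * T * (g : Matrix (Fin 3) (Fin 3) K) - 1) ∧
        ¬ LabelPlus σ ϖ d m ((g : Matrix (Fin 3) (Fin 3) K)⁻¹ * T * (g : Matrix (Fin 3) (Fin 3) K) - 1)) ↔
      (LatticeNearTransvShell ϖ ℓ m (T - 1) (mapGL g (stdLattice K 3)) ∧ ¬ LatticeLabelPlus σ ϖ d m (mapGL g (stdLattice K 3)) (T - 1)) := by
  rw [conj_sub_one, nearTransvShell_conj_iff_latticeNearTransvShell hϖ, labelPlus_conj_iff_latticeLabelPlus σ ϖ d m (T - 1) hg]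

/-- **THE `f_reg` CLAUSE**: `¬ InLevel ϖ m ((g⁻¹Tg − 1)²) ↔ ¬ LatticeInLevel ϖ m ((T − 1)²) (g·𝒪³)`. [cite: Kottwitz1986, §3] [cite: Rogawski1990, §4.9 Prop. 4.9.1 (b) p. 55] -/
theorem reg_profile_conj_iff {ϖ : K} (hϖ : ϖ ≠ 0) (m : ℕ) (T : Matrix (Fin 3) (Fin 3) K) (g : GL (Fin 3) K) :
    (¬ InLevel ϖ m (((g : Matrix (Fin 3) (Fin 3) K)⁻¹ * T * (g : Matrix (Fin 3) (Fin 3) K) - 1) *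
        ((g : Matrix (Fin 3) (Fin 3) K)⁻¹ * T * (g : Matrix (Fin 3) (Fin 3) K) - 1))) ↔
      ¬ LatticeInLevel ϖ m ((T - 1) * (T - 1)) (mapGL g (stdLattice K 3)) := by
  have hsq : ((g : Matrix (Fin 3) (Fin 3) K)⁻¹ * (T - 1) * (g : Matrix (Fin 3) (Fin 3) K)) * ((g : Matrix (Fin 3) (Fin 3) K)⁻¹ * (T - 1) * (g : Matrix (Fin 3) (Fin 3) K)) =
      (g : Matrix (Fin 3) (Fin 3) K)⁻¹ * ((T - 1) * (T - 1)) * (g : Matrix (Fin 3) (Fin 3) K) := by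
    rw [Matrix.mul_assoc ((g : Matrix (Fin 3) (Fin 3) K)⁻¹) (T - 1) (g : Matrix (Fin 3) (Fin 3) K), conj_mul_conj g (T - 1) (T - 1)]
    simp only [Matrix.mul_assoc]
  rw [conj_sub_one, hsq, inLevel_conj_iff_latticeInLevel hϖ]

end Summit.HodgeConjecture.HodgeConjecture.Cruxes.H413.F0P3cDyRamProfileLabelTransport

end
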